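import Mathlib
import Summits.QuantumFields.YangMills.Theses.QuantileBitPurity

/-!
# QuantileBitPurity — cap monotonicity between the filed items (planner glue, D-0145 LINE g12-B rev 3)

The deep-cap path (items ⟨23948⟩ `HolonomyQuantileSubQuartic`, ⟨23949⟩ `HolonomyLevyWindowDeep`, ⟨23950⟩ `QuantileBitDoorDeep`)
and the original path (⟨23922⟩, ⟨23923⟩, ⟨23925⟩) are related by trivial monotonicity in the core cap
(`1/5 ≤ 2/5`): the filed X1 implies the deep X1 (an `∃ γc ≤ cap` weakens as the cap grows) and the deep X2 implies
the filed X2 (a `∀ γc ≤ cap` strengthens as the cap grows).  Recorded here so that a proof of either sibling is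
usable on the other path.  No summit is proved.
-/

namespace Summit.QuantumFields.YangMills.Theorems.QuantileBitPurity

open Summit.QuantumFields.YangMills.Theses.QuantileBitPurity

/-- ⟨23922⟩ ⇒ ⟨23948⟩: the cap-`1/5` holonomy quantile implies the cap-`2/5` (sub-quartic) one. -/
theorem holonomyQuantileSubQuartic_of_offCore (h : HolonomyQuantileOffCore) : HolonomyQuantileSubQuartic := by
  obtain ⟨γc, h0, h1, rest⟩ := h
  exact ⟨γc, h0, by linarith, rest⟩

/-- ⟨23949⟩ ⇒ ⟨23923⟩: the deep Lévy window (every cap `≤ 2/5`) implies the filed one (every cap `≤ 1/5`). -/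
theorem holonomyLevyWindow_of_deep (h : HolonomyLevyWindowDeep) : HolonomyLevyWindow := by
  intro γc hγc
  exact h γc (by linarith)

/-- Mixed path: the ORIGINAL door ⟨23925⟩ together with the filed X1 ⟨23922⟩ and the DEEP X2 ⟨23949⟩ already gives the
femto-window purity deficit (so closing ⟨23922⟩+⟨23949⟩+⟨23925⟩ also feeds `Assembly`). -/
theorem window_of_offCore_deepLevy_door (h₁ : HolonomyQuantileOffCore) (h₂ : HolonomyLevyWindowDeep)
    (hD : QuantileBitDoor) :
    ∃ a : ℝ, 0 < a ∧ ∃ k β₀ : ℝ, ∃ L₀ : ℕ, ∀ β : ℝ, β₀ ≤ β → ∀ (L : ℕ) [NeZero L], L₀ ≤ L → (L : ℝ) ≤ β ^ a →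
      Summit.QuantumFields.YangMills.Theorems.FemtoTransferGap.TT.physTrace L β (2 * L) ≤
        (1 - β ^ (-k)) * Summit.QuantumFields.YangMills.Theorems.FemtoTransferGap.TT.physTrace L β L ^ 2 :=
  hD h₁ (holonomyLevyWindow_of_deep h₂)

/-- Mixed path 2: the DEEP door ⟨23950⟩ with the filed X1 ⟨23922⟩ (via monotonicity) and the deep X2 ⟨23949⟩. -/
theorem window_of_offCore_deepLevy_deepDoor (h₁ : HolonomyQuantileOffCore) (h₂ : HolonomyLevyWindowDeep)
    (hD : QuantileBitDoorDeep) :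
    ∃ a : ℝ, 0 < a ∧ ∃ k β₀ : ℝ, ∃ L₀ : ℕ, ∀ β : ℝ, β₀ ≤ β → ∀ (L : ℕ) [NeZero L], L₀ ≤ L → (L : ℝ) ≤ β ^ a →
      Summit.QuantumFields.YangMills.Theorems.FemtoTransferGap.TT.physTrace L β (2 * L) ≤
        (1 - β ^ (-k)) * Summit.QuantumFields.YangMills.Theorems.FemtoTransferGap.TT.physTrace L β L ^ 2 :=
  hD (holonomyQuantileSubQuartic_of_offCore h₁) h₂

end Summit.QuantumFields.YangMills.Theorems.QuantileBitPurity
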